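import Mathlib
import Literature.Analysis.OperatorTheory.CompactEmbeddingFormSpectrum
import Literature.NumberTheory.LFunctions.WeilSemilocalCompactnessProofs
import Literature.NumberTheory.LFunctions.WeilWindowSimpleEven
import Literature.NumberTheory.LFunctions.WeilExplicitProofs
import HarnessLib

/-!
# Stub `stub_zeroLevelNullVector`, helper file 1/5: compactness of the extension, spectral data; the polarised Weil form
(item stmt-RiemannHypothesis-2064, route route-RiemannHypothesis-RuelleBand; registered stub
`stub_zeroLevelNullVector` of line `cofinite-weil-index-staircase` — "a zero min–max level of the
window form is a null vector", the attainment half of the crossing lemma).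

Abstract Hilbert-space layer (sections `AbstractLayer`): `W` is a pre-Hilbert space over `ℂ`
(later: the window test functions with the form inner product `W(y ⋆ x̃) + C⟪x, y⟫_{L²}`),
`H` a Hilbert space (later: `L²(ℝ)`), `T : W →L[ℂ] H` bounded (later: `g ↦ [g]`).

* `stub_zeroLevelNullVector_subseq_of_norm_le`, `stub_zeroLevelNullVector_isCompactOperator_extend`:
  the sequential compact-embedding property on the core ("every `T`-normalised `W`-bounded sequence
  has a `T`-convergent subsequence", the shape of `ConnesConsaniMoscovici2025_thm_3_6`) makes the
  extension `T̂` of `T` to the completion `Ŵ = UniformSpace.Completion W` a compact operator.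
* `stub_zeroLevelNullVector_spectralData`: a Hilbert basis of `Ŵ` of eigenvectors of the compact
  Gram operator `K = T̂†T̂` (`Literature.Analysis.OperatorTheory.exists_hilbertBasis_eigenvectors`),
  `0 ≤ κᵢ ≤ ‖T̂‖²`, `κᵢ → 0` cofinitely, with the Parseval expansions `‖T̂ z‖² = Σ κᵢ|⟪bᵢ, z⟫|²`,
  `‖z‖² = Σ |⟪bᵢ, z⟫|²`. No injectivity (closability) of `T̂` is needed: kernel vectors carry `κᵢ = 0`.

Weil layer (registered sub-goal `stub_zeroLevelNullVector_B_conj_symm`): the polarised form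
`Q(g, h) := W(g ⋆ h̃)` (`W = weilFunctional`) is sesquilinear and Hermitian on test functions
(from the reality of `Q`, `weilQuadratic_im_holds`, by polarisation over `g + h` and `g + ih`).

No definitions, no named facts. References: M. Reed, B. Simon, *Methods of Modern Mathematical
Physics* I (Thm. VI.16) and IV (Thm. XIII.64); E. Bombieri, Rend. Lincei (9) 11 (2000) §3.
-/

set_option linter.dupNamespace false -- justified: the module path repeats `RiemannHypothesis` (summit = problem); header prescribed by the line lead

noncomputable section

open Complex MeasureTheory Filter Set
open scoped BigOperators Topology ComplexConjugate InnerProductSpace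

namespace Summit.RiemannHypothesis.RiemannHypothesis.Theorems.RuelleBandCofiniteCriticalLine

open Literature.NumberTheory.LFunctions

section AbstractLayer

variable {W : Type*} [NormedAddCommGroup W] [InnerProductSpace ℂ W]
variable {H : Type*} [NormedAddCommGroup H] [InnerProductSpace ℂ H] [CompleteSpace H]

section Abstract

/-- The extension `T̂` of a bounded map `T` on a pre-Hilbert space `W` to its completion agrees
with `T` on `W`. [folklore] -/
theorem stub_zeroLevelNullVector_extend_coe (T : W →L[ℂ] H) (x : W) :
    T.extend (UniformSpace.Completion.toComplL : W →L[ℂ] UniformSpace.Completion W)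
      (x : UniformSpace.Completion W) = T x :=
  ContinuousLinearMap.extend_eq T UniformSpace.Completion.denseRange_coe
    (UniformSpace.Completion.isUniformInducing_coe W) x

omit [CompleteSpace H] in
/-- **Un-normalised sequential compactness.** If every `T`-normalised, `W`-bounded sequence has a
`T`-convergent subsequence, then so does every `W`-bounded sequence (normalise, or pass to a
subsequence along which `‖T xₙ‖ → 0`). [folklore] -/
theorem stub_zeroLevelNullVector_subseq_of_norm_le (T : W →L[ℂ] H)
    (hcomp : ∀ (x : ℕ → W) (M : ℝ), (∀ n, ‖T (x n)‖ = 1) → (∀ n, ‖x n‖ ≤ M) →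
      ∃ (v : H) (φ : ℕ → ℕ), StrictMono φ ∧ Tendsto (fun n => T (x (φ n))) atTop (𝓝 v))
    (x : ℕ → W) (hx : ∀ n, ‖x n‖ ≤ 1) :
    ∃ (v : H) (φ : ℕ → ℕ), StrictMono φ ∧ Tendsto (fun n => T (x (φ n))) atTop (𝓝 v) := by
  set r : ℕ → ℝ := fun n => ‖T (x n)‖ with hr
  have hrmem : ∀ n, r n ∈ Icc (0 : ℝ) ‖T‖ := fun n =>
    ⟨norm_nonneg _, (T.le_opNorm (x n)).trans (by nlinarith [hx n, norm_nonneg T])⟩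
  obtain ⟨r₀, -, φ₁, hφ₁, hr₀⟩ := tendsto_subseq_of_bounded (Metric.isBounded_Icc (0 : ℝ) ‖T‖) hrmem
  by_cases h0 : r₀ ≤ 0
  · -- `‖T x (φ₁ n)‖ → r₀ ≤ 0`, hence `T x (φ₁ n) → 0`
    refine ⟨0, φ₁, hφ₁, ?_⟩
    have hr₀0 : r₀ = 0 :=
      le_antisymm h0 (ge_of_tendsto' hr₀ fun n => norm_nonneg (T (x (φ₁ n))))
    rw [tendsto_zero_iff_norm_tendsto_zero]
    rw [hr₀0] at hr₀
    exact hr₀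
  · push Not at h0
    -- eventually `r (φ₁ n) > r₀ / 2`
    have hev : ∀ᶠ n in atTop, r₀ / 2 < r (φ₁ n) :=
      hr₀.eventually_const_lt (by linarith)
    obtain ⟨N₀, hN₀⟩ := eventually_atTop.1 hev
    set ψ : ℕ → ℕ := fun n => φ₁ (n + N₀) with hψ
    have hψr : ∀ n, r₀ / 2 < r (ψ n) := fun n => hN₀ (n + N₀) (Nat.le_add_left _ _)
    have hψpos : ∀ n, 0 < r (ψ n) := fun n => lt_trans (by linarith) (hψr n)
    set y : ℕ → W := fun n => (((r (ψ n))⁻¹ : ℝ) : ℂ) • x (ψ n) with hy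
    have hTy : ∀ n, T (y n) = (((r (ψ n))⁻¹ : ℝ) : ℂ) • T (x (ψ n)) := fun n => by
      simp only [hy, map_smul]
    have hy1 : ∀ n, ‖T (y n)‖ = 1 := fun n => by
      rw [hTy, norm_smul, Complex.norm_real, Real.norm_of_nonneg (inv_nonneg.2 (hψpos n).le)]
      exact inv_mul_cancel₀ (hψpos n).ne'
    have hyM : ∀ n, ‖y n‖ ≤ 2 / r₀ := fun n => by
      rw [hy, norm_smul, Complex.norm_real, Real.norm_of_nonneg (inv_nonneg.2 (hψpos n).le)]
      have h1 : (r (ψ n))⁻¹ ≤ 2 / r₀ := by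
        rw [inv_le_comm₀ (hψpos n) (by positivity)]
        rw [inv_div]; linarith [hψr n]
      calc (r (ψ n))⁻¹ * ‖x (ψ n)‖ ≤ 2 / r₀ * 1 :=
            mul_le_mul h1 (hx _) (norm_nonneg _) (by positivity)
        _ = 2 / r₀ := mul_one _
    obtain ⟨v, φ₂, hφ₂, hv⟩ := hcomp y (2 / r₀) hy1 hyM
    refine ⟨((r₀ : ℝ) : ℂ) • v, fun n => ψ (φ₂ n), ?_, ?_⟩
    · exact hφ₁.comp ((hφ₂.add_const N₀))
    · have hxeq : ∀ n, T (x (ψ (φ₂ n))) = (((r (ψ (φ₂ n))) : ℝ) : ℂ) • T (y (φ₂ n)) := fun n => by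
        rw [hTy, smul_smul, ← Complex.ofReal_mul, mul_inv_cancel₀ (hψpos _).ne', Complex.ofReal_one,
          one_smul]
      simp_rw [hxeq]
      refine Tendsto.smul ?_ hv
      have h1 : Tendsto (fun n => r (ψ (φ₂ n))) atTop (𝓝 r₀) :=
        (hr₀.comp (tendsto_add_atTop_nat N₀)).comp hφ₂.tendsto_atTop
      exact (Complex.continuous_ofReal.tendsto r₀).comp h1

/-- **Compactness of the extension to the completion.** Under the sequential compactness hypothesis
on the core, the extension `T̂ : Ŵ → H` is a compact operator: the closure of the image of the
core unit ball is sequentially compact, and the image of the unit ball of `Ŵ` lies in it. [folklore] -/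
theorem stub_zeroLevelNullVector_isCompactOperator_extend (T : W →L[ℂ] H)
    (hcomp : ∀ (x : ℕ → W) (M : ℝ), (∀ n, ‖T (x n)‖ = 1) → (∀ n, ‖x n‖ ≤ M) →
      ∃ (v : H) (φ : ℕ → ℕ), StrictMono φ ∧ Tendsto (fun n => T (x (φ n))) atTop (𝓝 v)) :
    IsCompactOperator
      (T.extend (UniformSpace.Completion.toComplL : W →L[ℂ] UniformSpace.Completion W)) := by
  set Th := T.extend (UniformSpace.Completion.toComplL : W →L[ℂ] UniformSpace.Completion W)
    with hTh
  set K : Set H := closure (T '' Metric.closedBall (0 : W) 1) with hK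
  -- `K` is sequentially compact, hence compact
  have hKseq : IsSeqCompact K := by
    intro u hu
    have hnear : ∀ n, ∃ x : W, x ∈ Metric.closedBall (0 : W) 1 ∧
        dist (u n) (T x) < 1 / ((n : ℝ) + 1) := fun n => by
      obtain ⟨w, ⟨x, hx, rfl⟩, hw⟩ := Metric.mem_closure_iff.1 (hu n) (1 / ((n : ℝ) + 1))
        (by positivity)
      exact ⟨x, hx, hw⟩
    choose x hxball hxdist using hnear
    have hx1 : ∀ n, ‖x n‖ ≤ 1 := fun n => mem_closedBall_zero_iff.1 (hxball n)
    obtain ⟨v, φ, hφ, hv⟩ := stub_zeroLevelNullVector_subseq_of_norm_le T hcomp x hx1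
    have huv : Tendsto (u ∘ φ) atTop (𝓝 v) := by
      rw [Metric.tendsto_atTop] at hv ⊢
      intro ε hε
      obtain ⟨N₁, hN₁⟩ := hv (ε / 2) (half_pos hε)
      obtain ⟨N₂, hN₂⟩ := exists_nat_gt (2 / ε)
      refine ⟨max N₁ N₂, fun n hn => ?_⟩
      have hn1 : N₁ ≤ n := le_of_max_le_left hn
      have hn2 : (N₂ : ℝ) ≤ φ n := by
        exact_mod_cast (le_of_max_le_right hn).trans (hφ.id_le n)
      have hd1 := hxdist (φ n)
      have hd2 : 1 / ((φ n : ℝ) + 1) < ε / 2 := by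
        rw [div_lt_iff₀ (by positivity)]
        have : 2 / ε < (φ n : ℝ) + 1 := by linarith
        rw [div_lt_iff₀ hε] at this
        linarith
      calc dist ((u ∘ φ) n) v ≤ dist (u (φ n)) (T (x (φ n))) + dist (T (x (φ n))) v :=
            dist_triangle _ _ _
        _ < ε / 2 + ε / 2 := add_lt_add (hd1.trans hd2) (hN₁ n hn1)
        _ = ε := add_halves ε
    refine ⟨v, ?_, φ, hφ, huv⟩
    exact isClosed_closure.mem_of_tendsto huv (Eventually.of_forall fun n => hu (φ n))
  have hKc : IsCompact K := isCompact_iff_isSeqCompact.2 hKseq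
  refine ⟨K, hKc, ?_⟩
  -- the unit ball of the completion is mapped into `K`
  have hsub : Metric.ball (0 : UniformSpace.Completion W) 1 ⊆ Th ⁻¹' K := by
    intro z hz
    have hdense : Dense (Set.range ((↑) : W → UniformSpace.Completion W)) :=
      UniformSpace.Completion.denseRange_coe
    have hz' : z ∈ closure (Metric.ball (0 : UniformSpace.Completion W) 1 ∩
        Set.range ((↑) : W → UniformSpace.Completion W)) :=
      hdense.open_subset_closure_inter Metric.isOpen_ball hz
    have himg : Th z ∈ closure (Th '' (Metric.ball (0 : UniformSpace.Completion W) 1 ∩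
        Set.range ((↑) : W → UniformSpace.Completion W))) :=
      image_closure_subset_closure_image Th.continuous ⟨z, hz', rfl⟩
    refine closure_mono ?_ himg
    rintro _ ⟨w, ⟨hw, ⟨x, rfl⟩⟩, rfl⟩
    refine ⟨x, ?_, ?_⟩
    · rw [mem_closedBall_zero_iff]
      rw [mem_ball_zero_iff, UniformSpace.Completion.norm_coe] at hw
      exact hw.le
    · exact (stub_zeroLevelNullVector_extend_coe T x).symm
  exact Filter.mem_of_superset (Metric.ball_mem_nhds 0 one_pos) hsub

end Abstract

/-! ### Spectral data of `T̂† T̂` -/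

section Spectral

variable {Q : Type*} [NormedAddCommGroup Q] [InnerProductSpace ℂ Q] [CompleteSpace Q]

/-- **Spectral data of the Gram operator `K = T̂† T̂` of a compact map `T̂ : Q → H` between Hilbert
spaces**: a Hilbert basis `b` of `Q` of eigenvectors of `K`, `K bᵢ = κᵢ bᵢ`, with
`0 ≤ κᵢ ≤ ‖T̂‖²`, `κᵢ → 0` cofinitely, `⟪T̂ bᵢ, T̂ z⟫ = κᵢ ⟪bᵢ, z⟫`, and the two Parseval expansions
`‖T̂ z‖² = Σ κᵢ |⟪bᵢ, z⟫|²`, `‖z‖² = Σ |⟪bᵢ, z⟫|²` (Hilbert–Schmidt / F. Riesz; Reed–Simon I,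
Thm. VI.16). [folklore] -/
theorem stub_zeroLevelNullVector_spectralData (Th : Q →L[ℂ] H) (hTh : IsCompactOperator Th) :
    ∃ (s : Set Q) (b : HilbertBasis s ℂ Q) (κ : s → ℝ),
      (∀ i, 0 ≤ κ i) ∧ (∀ i, κ i ≤ ‖Th‖ ^ 2) ∧ Tendsto κ cofinite (𝓝 0) ∧
      (∀ i (z : Q), ⟪Th (b i), Th z⟫_ℂ = (κ i : ℂ) * ⟪b i, z⟫_ℂ) ∧
      (∀ z : Q, HasSum (fun i => κ i * ‖⟪b i, z⟫_ℂ‖ ^ 2) (‖Th z‖ ^ 2)) ∧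
      (∀ z : Q, HasSum (fun i => ‖⟪b i, z⟫_ℂ‖ ^ 2) (‖z‖ ^ 2)) := by
  set K : Q →L[ℂ] Q := (ContinuousLinearMap.adjoint Th).comp Th with hK
  have hKc : IsCompactOperator K := hTh.clm_comp (ContinuousLinearMap.adjoint Th)
  have hKpos : K.IsPositive := ContinuousLinearMap.isPositive_adjoint_comp_self Th
  have hKsym : (K : Q →ₗ[ℂ] Q).IsSymmetric := hKpos.isSelfAdjoint.isSymmetric
  have hKinner : ∀ x y : Q, ⟪K x, y⟫_ℂ = ⟪Th x, Th y⟫_ℂ := fun x y => by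
    simp only [hK, ContinuousLinearMap.coe_comp, Function.comp_apply,
      ContinuousLinearMap.adjoint_inner_left]
  have hKinner' : ∀ x y : Q, ⟪x, K y⟫_ℂ = ⟪Th x, Th y⟫_ℂ := fun x y => by
    simp only [hK, ContinuousLinearMap.coe_comp, Function.comp_apply,
      ContinuousLinearMap.adjoint_inner_right]
  obtain ⟨s, b, κ, -, hKb⟩ :=
    Literature.Analysis.OperatorTheory.exists_hilbertBasis_eigenvectors hKc hKsym
  have hk4 : ∀ i (z : Q), ⟪Th (b i), Th z⟫_ℂ = (κ i : ℂ) * ⟪b i, z⟫_ℂ := fun i z => by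
    rw [← hKinner, hKb i, inner_smul_left, RCLike.conj_ofReal]
    rfl
  have hκ : ∀ i, κ i = ‖Th (b i)‖ ^ 2 := fun i => by
    have h := hk4 i (b i)
    rw [inner_self_eq_norm_sq_to_K, inner_self_eq_norm_sq_to_K, b.orthonormal.1 i] at h
    have h2 : ((‖Th (b i)‖ ^ 2 : ℝ) : ℂ) = ((κ i : ℝ) : ℂ) := by
      push_cast
      simpa using h
    exact_mod_cast h2.symm
  refine ⟨s, b, κ, fun i => ?_, fun i => ?_, ?_, hk4, fun z => ?_, fun z => ?_⟩
  · rw [hκ]; positivity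
  · rw [hκ]
    have h1 : ‖Th (b i)‖ ≤ ‖Th‖ := by
      have := Th.le_opNorm (b i)
      rwa [b.orthonormal.1 i, mul_one] at this
    exact pow_le_pow_left₀ (norm_nonneg _) h1 2
  · have h := Literature.Analysis.OperatorTheory.tendsto_norm_eigenvalue_cofinite hKc b.orthonormal
      (μ := fun i => ((κ i : ℝ) : ℂ)) (fun i => hKb i)
    refine (tendsto_congr fun i => ?_).1 h
    rw [Complex.norm_real, Real.norm_eq_abs, abs_of_nonneg]
    rw [hκ]; positivity
  · have h := b.hasSum_inner_mul_inner z (K z)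
    have h2 : ∀ i, ⟪z, b i⟫_ℂ * ⟪b i, K z⟫_ℂ = ((κ i * ‖⟪b i, z⟫_ℂ‖ ^ 2 : ℝ) : ℂ) := fun i => by
      rw [hKinner', hk4, ← inner_conj_symm z (b i)]
      push_cast
      rw [← Complex.conj_mul']
      ring
    have h3 : ⟪z, K z⟫_ℂ = ((‖Th z‖ ^ 2 : ℝ) : ℂ) := by
      rw [hKinner', inner_self_eq_norm_sq_to_K]
      push_cast
      rfl
    simp_rw [h2, h3] at h
    exact Complex.hasSum_ofReal.1 h
  · exact Literature.Analysis.OperatorTheory.hasSum_norm_inner_sq b z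

end Spectral

end AbstractLayer

/-! ### The polarised Weil form `Q(g, h) := W(g ⋆ h̃)` is sesquilinear and Hermitian -/

section Sesquilinear

variable {g h k : ℝ → ℂ}

/-- Additivity of `Q(g, h) = W(g ⋆ h̃)` in `g`. [folklore] -/
theorem stub_zeroLevelNullVector_B_add_left (hg : IsWeilTest g) (hh : IsWeilTest h)
    (hk : IsWeilTest k) :
    weilFunctional (weilConv (g + h) (weilReflect k)) =
      weilFunctional (weilConv g (weilReflect k)) + weilFunctional (weilConv h (weilReflect k)) := by
  rw [weilConv_add_left hg hh hk.weilReflect,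
    weilFunctional_add (hg.weilConv hk.weilReflect) (hh.weilConv hk.weilReflect)]

/-- Additivity of `Q(g, h) = W(g ⋆ h̃)` in `h`. [folklore] -/
theorem stub_zeroLevelNullVector_B_add_right (hg : IsWeilTest g) (hh : IsWeilTest h)
    (hk : IsWeilTest k) :
    weilFunctional (weilConv g (weilReflect (h + k))) =
      weilFunctional (weilConv g (weilReflect h)) + weilFunctional (weilConv g (weilReflect k)) := by
  rw [weilReflect_add, weilConv_add_right hg hh.weilReflect hk.weilReflect,
    weilFunctional_add (hg.weilConv hh.weilReflect) (hg.weilConv hk.weilReflect)]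

/-- Homogeneity of `Q(g, h)` in `g` (no hypotheses). [folklore] -/
theorem stub_zeroLevelNullVector_B_smul_left (c : ℂ) (g h : ℝ → ℂ) :
    weilFunctional (weilConv (c • g) (weilReflect h)) =
      c * weilFunctional (weilConv g (weilReflect h)) := by
  rw [show c • g = fun t => c * g t from rfl, weilConv_const_mul_left, weilFunctional_const_mul]

/-- Conjugate homogeneity of `Q(g, h)` in `h` (no hypotheses). [folklore] -/
theorem stub_zeroLevelNullVector_B_smul_right (c : ℂ) (g h : ℝ → ℂ) :
    weilFunctional (weilConv g (weilReflect (c • h))) =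
      conj c * weilFunctional (weilConv g (weilReflect h)) := by
  rw [show c • h = fun t => c * h t from rfl, weilReflect_const_mul, weilConv_const_mul_right,
    weilFunctional_const_mul]

/-- **Hermitian symmetry** `conj Q(g, h) = Q(h, g)` for test functions, from the reality of
`Q(f) = W(f ⋆ f̃)` (`weilQuadratic_im_holds`) by polarisation over `g + h` and `g + i h`
(Bombieri 2000 §3 / Yoshida 1992: `T[f * ḡ*]` is a hermitian form). [folklore] -/
theorem stub_zeroLevelNullVector_B_conj_symm :
    ∀ {g h : ℝ → ℂ}, IsWeilTest g → IsWeilTest h →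
      conj (weilFunctional (weilConv g (weilReflect h))) =
        weilFunctional (weilConv h (weilReflect g)) := by
  intro g h hg hh
  set x := weilFunctional (weilConv g (weilReflect h)) with hx
  set y := weilFunctional (weilConv h (weilReflect g)) with hy
  have hreal : ∀ {f : ℝ → ℂ}, IsWeilTest f → (weilQuadratic f).im = 0 := fun hf =>
    weilQuadratic_im_holds hf
  have h1 : (x + y).im = 0 := by
    have e := weilQuadratic_add hg hh
    have : x + y = weilQuadratic (g + h) - weilQuadratic g - weilQuadratic h := by
      rw [e]; ring
    rw [this, Complex.sub_im, Complex.sub_im, hreal (hg.add hh), hreal hg, hreal hh]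
    ring
  have hIh : IsWeilTest (I • h) := hh.const_mul I
  have h2 : (-I * x + I * y).im = 0 := by
    have e := weilQuadratic_add hg hIh
    rw [stub_zeroLevelNullVector_B_smul_right, stub_zeroLevelNullVector_B_smul_left,
      Complex.conj_I] at e
    have : -I * x + I * y = weilQuadratic (g + I • h) - weilQuadratic g - weilQuadratic (I • h) := by
      rw [e]; ring
    rw [this, Complex.sub_im, Complex.sub_im, hreal (hg.add hIh), hreal hg, hreal hIh]
    ring
  apply Complex.ext
  · rw [Complex.conj_re]
    simp only [Complex.add_im, Complex.mul_im, Complex.neg_re, Complex.neg_im, Complex.I_re,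
      Complex.I_im] at h2
    linarith
  · rw [Complex.conj_im]
    rw [Complex.add_im] at h1
    linarith

end Sesquilinear

end Summit.RiemannHypothesis.RiemannHypothesis.Theorems.RuelleBandCofiniteCriticalLine

end
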